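import Summits.QuantumFields.YangMills.Theorems.LuscherReductionDressedRitzPolyakovLiftStaticsPrep
import Literature.MathematicalPhysics.QuantumFieldTheory.LatticeGaugeStaticPotentialProofs
import HarnessLib

/-!
# Axis permutations of the spatial torus are symmetries of the femto transfer operator: kernel, physical test functions,
# `transferApply`, and every raw vacuum (`φ ∘ configPerm π = φ` pointwise)

Fleet-service module of seat ym-infvol-p1 g5 (route `LuscherReduction`, femto rung R2b1; bears on crux child `DressedRitz` =
stmt-QuantumFields-20205, line «polyakovlift», stub S-STAT `stub_liftStatics`).  The static clause (o2) of the line asks that one-site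
eigen-ratio observables be uncorrelated to `O(λ)` under the vacuum law of the flowed Polyakov triple; the part of that covariance matrix which
vanishes EXACTLY is governed by the lattice symmetries shared by the fine theory and the one-site model.  This module supplies the first
half of that symmetry for the group `S₃` of PERMUTATIONS OF THE COORDINATE AXES (tree `configPerm π`, `sitePerm π`, `plaquetteHolonomy_configPerm`,
`wilsonAction_configPerm` of `Literature/…/LatticeGaugeStaticPotentialProofs.lean`):

* §1 `timeCoupling_configPerm`, `transferKernel_su2Rep_configPerm` — the spatial transfer kernel `K_β` is invariant; `measurePreserving_configPerm'`
  — so is the product Haar measure `configMeasure`; `l2_comp_configPerm`;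
* §2 `configPerm_gaugeTransform`, `configPerm_twist`, `IsPhys.comp_configPerm` — gauge transformations and centre twists are conjugated into
  gauge transformations and centre twists, so `ψ ∘ configPerm π` is a physical zero-flux test function when `ψ` is;
* §3 `transferApply_comp_configPerm` — `K_β (ψ ∘ P) = (K_β ψ) ∘ P` (change of variables);
* §4 ★ `rawVacuum_comp_configPerm` — every physical exact top eigenfunction (`K_βφ = λ₀φ` pointwise; in particular every raw vacuum) is INVARIANT: `φ (configPerm π U) = φ U`
  for all `U` (the transformed Perron–Frobenius state is again a positive normalised top eigenfunction, hence equal to it by Jentzsch's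
  simplicity — `rawVacuum_eq_smul_of_gap`; a raw vacuum is `±Ω`).

Companions: `…FemtoTransferGapSlabFlowLiftAxisPermutation.lean` (the Wilson flow and the Polyakov triple are `S₃`-equivariant) and
`…DressedRitzPolyakovLiftStaticsSymmetry.lean` (the law of the flowed Polyakov triple is `S₃`-invariant; symmetry zeros of clause (o2)).
HONEST FRAMING: fixed-lattice symmetry bookkeeping, every `L ≥ 1`, every real `β`; no renormalisation-group content; nothing here bears on
infinite volume, the continuum limit or the Clay gap.  References: M. Lüscher, NPB 219 (1983) 233, §2 (cubic group on the torus)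
[cite: Luscher1983, §2]; Reed–Simon IV [cite: ReedSimonIV1978, Thm XIII.43–44].
-/

set_option autoImplicit false

noncomputable section

open MeasureTheory Filter Topology
open Literature.MathematicalPhysics.QuantumFieldTheory
open Literature.MathematicalPhysics.QuantumLattice
open scoped BigOperators

namespace Summit.QuantumFields.YangMills.Theorems.FemtoTransferGap

open Summit.QuantumFields.YangMills.Theorems.FemtoTransferGap.PhysL2

/-! ## §1 The kernel and the a-priori measure are invariant under axis permutations -/

section Kernel

variable {N : ℕ} {G : Type*} [Group G] (ρ : G →* Matrix (Fin N) (Fin N) ℂ) {L : ℕ} [NeZero L]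

omit [NeZero L] in
/-- `(edgePerm π)⁻¹ e = (sitePerm π⁻¹ e.1, π⁻¹ e.2)`. [folklore] -/
theorem edgePerm_symm_apply (π : Equiv.Perm (Fin 3)) (e : Edge 3 L) :
    (edgePerm (L := L) π).symm e = (sitePerm π.symm e.1, π.symm e.2) := rfl

variable [MeasurableSpace G]

/-- The time-like coupling `∑ₑ Re tr ρ(UₑVₑ⁻¹)` is invariant under a simultaneous axis permutation of both slices. [folklore] -/
theorem timeCoupling_configPerm (π : Equiv.Perm (Fin 3)) (U V : GaugeConfig 3 L G) :
    timeCoupling ρ (configPerm π U) (configPerm π V) = timeCoupling ρ U V := by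
  unfold timeCoupling
  simp only [configPerm_apply]
  exact Fintype.sum_equiv (edgePerm π).symm _ _ fun e => by rw [edgePerm_symm_apply]

end Kernel

section KernelSU2

variable {L : ℕ} [NeZero L]

/-- **The `SU(2)` spatial transfer kernel is invariant under axis permutations**: `K_β(PU, PV) = K_β(U, V)` (time coupling and Wilson
action are sums over edges ∕ plaquettes, re-indexed by the permutation; `wilsonAction_configPerm`). [cite: Luscher1983, §2] -/
theorem transferKernel_su2Rep_configPerm (β : ℝ) (π : Equiv.Perm (Fin 3)) (U V : GaugeConfig 3 L SU2) :
    transferKernel su2Rep β (configPerm π U) (configPerm π V) = transferKernel su2Rep β U V := by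
  unfold transferKernel
  rw [timeCoupling_configPerm, wilsonAction_configPerm su2Rep continuous_su2Rep, wilsonAction_configPerm su2Rep continuous_su2Rep]

/-- Axis permutations preserve the a-priori product Haar measure `configMeasure`. [folklore] -/
theorem measurePreserving_configPerm' (π : Equiv.Perm (Fin 3)) :
    MeasurePreserving (configPerm (G := SU2) (L := L) π) (configMeasure SU2 L) (configMeasure SU2 L) := by
  unfold configMeasure
  exact measurePreserving_arrowCongr' (fun _ : Edge 3 L => haarProbability SU2) (fun _ : Edge 3 L => haarProbability SU2)
    (edgePerm π) (MeasurableEquiv.refl SU2) fun _ => MeasurePreserving.id _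

/-- `⟨ψ ∘ P, φ ∘ P⟩ = ⟨ψ, φ⟩` for an axis permutation `P`. [folklore] -/
theorem l2_comp_configPerm (π : Equiv.Perm (Fin 3)) (ψ φ : GaugeConfig 3 L SU2 → ℝ) :
    l2 (fun U => ψ (configPerm π U)) (fun U => φ (configPerm π U)) = l2 ψ φ := by
  unfold l2
  exact (measurePreserving_configPerm' π).integral_comp' (f := configPerm π) (fun U => ψ U * φ U)

end KernelSU2

/-! ## §2 Axis permutations conjugate gauge transformations and centre twists; physical test functions stay physical -/

section Phys

variable {G : Type*} [Group G] [MeasurableSpace G] {L : ℕ}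

/-- `P_π (U^g) = (P_π U)^{g ∘ σ}` with `σ = sitePerm π⁻¹`: an axis permutation conjugates a gauge transformation into a gauge
transformation. [folklore] -/
theorem configPerm_gaugeTransform (π : Equiv.Perm (Fin 3)) (g : Site 3 L → G) (U : GaugeConfig 3 L G) :
    configPerm π (gaugeTransform g U) = gaugeTransform (g ∘ sitePerm π.symm) (configPerm π U) := by
  funext e
  simp only [configPerm_apply, gaugeTransform, Function.comp_apply, sitePerm_shift]

/-- `P_π (twist_k z U) = twist_{π k} z (P_π U)`: an axis permutation conjugates the centre twist through the plane `x_k = 0` into the centre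
twist through `x_{π k} = 0`. [cite: tHooft1979] -/
theorem configPerm_twist (π : Equiv.Perm (Fin 3)) (k : Fin 3) (z : G) (U : GaugeConfig 3 L G) :
    configPerm π (twist k z U) = twist (π k) z (configPerm π U) := by
  funext e
  simp only [configPerm_apply, twist, sitePerm_apply, Equiv.symm_symm]
  have hiff : π.symm e.2 = k ↔ e.2 = π k := by
    constructor
    · intro h; rw [← h, Equiv.apply_symm_apply]
    · intro h; rw [h, Equiv.symm_apply_apply]
  by_cases h : e.2 = π k ∧ e.1 (π k) = 0
  · rw [if_pos h, if_pos (by exact ⟨hiff.mpr h.1, h.2⟩)]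
  · rw [if_neg h, if_neg (by exact fun h' => h ⟨hiff.mp h'.1, h'.2⟩)]

/-- **`ψ ∘ configPerm π` is a physical zero-flux test function when `ψ` is** (measurable, bounded, gauge invariant by
`configPerm_gaugeTransform`, twist invariant by `configPerm_twist`). [cite: Luscher1983, §2] -/
theorem IsPhys.comp_configPerm {ψ : GaugeConfig 3 L G → ℝ} (hψ : IsPhys ψ) (π : Equiv.Perm (Fin 3)) :
    IsPhys fun U => ψ (configPerm π U) := by
  obtain ⟨C, hC⟩ := hψ.bounded
  refine ⟨hψ.measurable.comp (configPerm π).measurable, ⟨C, fun U => hC _⟩, fun g U => ?_, fun k z hz U => ?_⟩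
  · show ψ (configPerm π (gaugeTransform g U)) = ψ (configPerm π U)
    rw [configPerm_gaugeTransform, hψ.gaugeInv]
  · show ψ (configPerm π (twist k z U)) = ψ (configPerm π U)
    rw [configPerm_twist, hψ.zeroFlux _ z hz]

end Phys

/-! ## §3 The transfer operator commutes with axis permutations -/

section Apply

variable {L : ℕ} [NeZero L]

/-- **`K_β (ψ ∘ P) = (K_β ψ) ∘ P`** for an axis permutation `P` (change of variables `V = P W` in `∫ K_β(PU, V) ψ(V) dV`, kernel invariance,
measure preservation). [cite: Luscher1983, §2] -/
theorem transferApply_comp_configPerm (β : ℝ) (ψ : GaugeConfig 3 L SU2 → ℝ) (π : Equiv.Perm (Fin 3)) :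
    transferApply β (fun U => ψ (configPerm π U)) = fun U => transferApply β ψ (configPerm π U) := by
  funext U
  rw [transferApply_apply, transferApply_apply,
    ← (measurePreserving_configPerm' π).integral_comp' (f := configPerm π)
      (fun V => transferKernel su2Rep β (configPerm π U) V * ψ V)]
  simp only [transferKernel_su2Rep_configPerm]

end Apply

/-! ## §4 ★ Every raw vacuum is invariant under axis permutations -/

section Vacuum

variable {L : ℕ} [NeZero L]

/-- **A raw vacuum is invariant under axis permutations, pointwise**: if `φ` is physical and `K_βφ = λ₀φ` pointwise (normalised or not) then
`φ (configPerm π U) = φ U` for every `U`.  Proof: the Perron–Frobenius state `Ω > 0` of `PhysL2.exists_groundState` composed with `P` is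
again physical (§2), normalised (§1), an exact top eigenfunction (§3) and positive, so by Jentzsch's simplicity (`rawVacuum_eq_smul_of_gap`)
`Ω ∘ P = bΩ` with `b > 0`, `b² = 1`, i.e. `Ω ∘ P = Ω`; and `φ = aΩ`. [cite: ReedSimonIV1978, Thm XIII.43 and Thm XIII.44] [cite: Luscher1983, §2] -/
theorem rawVacuum_comp_configPerm (β : ℝ) {φ : GaugeConfig 3 L SU2 → ℝ} (hφ : IsPhys φ)
    (heig : transferApply β φ = levelValue su2Rep L β 0 • φ) (π : Equiv.Perm (Fin 3)) (U : GaugeConfig 3 L SU2) :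
    φ (configPerm π U) = φ U := by
  obtain ⟨Ω, θ, c, hΩ, hc, hcle, hn, heigΩ, -, hθ, hgap⟩ := PhysL2.exists_groundState (L := L) β
  rw [levelValue_zero] at heig
  -- `φ = a Ω`
  have hφΩ := PolyakovLift.rawVacuum_eq_smul_of_gap β hφ heig hΩ hn heigΩ hθ hgap
  -- `Ω ∘ P` is a positive normalised physical top eigenfunction
  set ΩP : GaugeConfig 3 L SU2 → ℝ := fun V => Ω (configPerm π V) with hΩP
  have hΩP_phys : IsPhys ΩP := hΩ.comp_configPerm π
  have hΩP_eig : transferApply β ΩP = topValue su2Rep L β • ΩP := by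
    rw [hΩP, transferApply_comp_configPerm, heigΩ]
    funext V
    simp only [Pi.smul_apply, smul_eq_mul]
  have hΩPΩ := PolyakovLift.rawVacuum_eq_smul_of_gap β hΩP_phys hΩP_eig hΩ hn heigΩ hθ hgap
  set b : ℝ := l2 ΩP Ω with hb
  -- `b > 0` (both states positive) and `b² = 1` (both normalised), so `b = 1`
  have hbpos : 0 < b := by
    have h1 : ΩP U = b * Ω U := hΩPΩ U
    have hΩPU : 0 < ΩP U := hc.trans_le (hcle _)
    have hΩU : 0 < Ω U := hc.trans_le (hcle U)
    by_contra hle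
    push Not at hle
    have : ΩP U ≤ 0 := by rw [h1]; exact mul_nonpos_of_nonpos_of_nonneg hle hΩU.le
    exact absurd this (not_le.mpr hΩPU)
  have hnormP : l2 ΩP ΩP = 1 := by rw [hΩP, l2_comp_configPerm, hn]
  have hb1 : b = 1 := by
    have hfun : ΩP = b • Ω := funext fun V => by rw [Pi.smul_apply, smul_eq_mul]; exact hΩPΩ V
    have h2 : l2 ΩP ΩP = b * b * l2 Ω Ω := by rw [hfun, OpPlat.l2_smul_smul]
    rw [hnormP, hn, mul_one] at h2
    nlinarith
  -- conclude
  have hΩinv : Ω (configPerm π U) = Ω U := by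
    have h := hΩPΩ U
    rw [hb1, one_mul] at h
    exact h
  rw [hφΩ (configPerm π U), hφΩ U, hΩinv]

/-- Function form: `φ ∘ configPerm π = φ` for a raw vacuum `φ`. [cite: ReedSimonIV1978, Thm XIII.43 and Thm XIII.44] -/
theorem rawVacuum_comp_configPerm_eq (β : ℝ) {φ : GaugeConfig 3 L SU2 → ℝ} (hφ : IsPhys φ)
    (heig : transferApply β φ = levelValue su2Rep L β 0 • φ) (π : Equiv.Perm (Fin 3)) :
    (fun U => φ (configPerm π U)) = φ :=
  funext fun U => rawVacuum_comp_configPerm β hφ heig π U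

end Vacuum

end Summit.QuantumFields.YangMills.Theorems.FemtoTransferGap

end
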